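import Mathlib
import Literature.Analysis.FluidPDE.SelfSimilar
import Literature.Analysis.FluidPDE.AxisymmetricEuler
import Literature.Analysis.FluidPDE.TypeIAncientMild
import Literature.Analysis.FluidPDE.PineauVicolRSS
import Literature.Analysis.FluidPDE.PineauVicolRDSSLeray
import Summits.NavierStokesRegularity.NavierStokesRegularity.Theorems.DssFarFieldSlavingBlowupTypeIDssProfileSmoothRepresentativeAe
import Summits.NavierStokesRegularity.NavierStokesRegularity.Theorems.DssFarFieldSlavingBlowupTypeIDssProfileAxisymmetricEmpty
import Summits.NavierStokesRegularity.NavierStokesRegularity.Theorems.CorkscrewDynamoCorkscrewProfileAngleTools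
import Summits.NavierStokesRegularity.NavierStokesRegularity.Theorems.DssFarFieldSlavingBlowupTypeIDssProfileReversingInfiniteOrderTwist
import HarnessLib

/-!
# Spatio-temporal symmetries of Type-I rotated-DSS fields: the commutator is a spatial symmetry (T25)

HONEST FRAMING (pub-ns-dss theory seat g3, 2026-08-22). What this is: a LIOUVILLE / RIGIDITY statement for
the census class of the cell (Type-I ancient mild fields), closing the gap the red team recorded as
«NOT covered by T22/T22′/T23: SPATIO-TEMPORAL reversing symmetries (improper sub-period-twist members; open
sub-cell of K4-C_m)» (R-41, SEARCH-LEDGER §A K0d′/K0e wording guards). What this is NOT: no claim about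
Navier–Stokes regularity or blow-up; an empty cell is a solver control, not mathematics about the flow;
no number.

MECHANISM (pure algebra, then KNSS). If a field `V` carries TWO rotated-DSS structures
`V(t,x) = c A⁻¹ V(c²t, cAx)` and `V(t,x) = μ B⁻¹ V(μ²t, μBx)` (factors `c, μ > 0`, linear isometries
`A, B`; the first is the class hypothesis H2 with `A = R_θ`, the second a SPATIO-TEMPORAL symmetry, i.e. a
symmetry of the orbit that is not a symmetry of the slices), then comparing the two orders of composition
shows that EVERY SLICE is equivariant under the COMMUTATOR `B A B⁻¹ A⁻¹` (`slices_equivariant_commutator`).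
For `A = R_θ` and `B = g` rotation-REVERSING (`g R_φ = R_{−φ} g`: vertical mirrors, horizontal π-rotations
and their `σ_h`/inversion composites) the commutator is `R_{−2θ}`
(`twistSq_equivariant_of_spatioTemporalReversing`) — the same conclusion as the landed K0d lemma
`ReversingIsotropy.twistSq_equivariant_of_reverses`, but WITHOUT assuming that `g` is a symmetry of any
slice. Hence (KNSS Thm 5.3 via `typeI_ancient_axisymmetric_ae_zero`): if `θ/π ∉ ℚ` the field is trivial
(`spatioTemporalReversing_trivial`, Oseen gauge; `rdssClass_spatioTemporalReversing_empty`, CLASS level,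
hypothesis list = `RdssProfileTruncation`'s with `R = R_θ` plus `IsRotatedDSS μ g u`); if `θ/π ∈ ℚ` the
slices have the finite-order rotational symmetry `R_{2θ}` (the theorem itself), so the large-order
Liouville theorem (E12) applies to its order.

CENSUS READING (K4, co-rotating profiles `u = pvAnsatz α W`, `W` `L`-periodic, `L = 2 log c`; the automatic
twist is `θ = −αL`, `PineauVicol2026.isRotatedDSS_pvAnsatz`): a K4 member admitting a spatio-temporal
reversing symmetry `(μ, g)` (any `μ > 0`) has `R_{2αL}`-equivariant slices; it is THEOREM-EMPTY unless
`αL/π ∈ ℚ` (`corotating_spatioTemporalReversing_trivial`), and then `R_{2αL}` lies in the spatial isotropy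
(so with isotropy exactly `C_m`: `2αL ∈ (2π/m)ℤ`, a FINITE set of `α` per `L` inside K4's window
`αL ∈ (0, 2π/m)`). LEVELS (lead A22): Oseen-gauge classical / CLASS as named. NOT covered: spatio-temporal
symmetries `(μ, g)` with `g` TILTED (`g e₃ ≠ ±e₃`) — their commutator with `R_θ` is a fixed tilted
SPATIAL symmetry of every slice, which at `θ/2π ∉ ℚ` feeds T23 (theory file TiltedIsotropyEmptyTree.lean,
section T25T) and at rational `θ` only yields a finite conjugate family; and `g ∈ C_∞h` (commutator trivial).

PRINTED SKELETON (lit seat g3, LIT-COVERAGE §11): the algebra «commutators of spatio-temporal symmetries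
are spatial symmetries» is equivariant dynamics — Golubitsky–Stewart 2002, Ch. 3 Lemma 3.1(b) (the
temporal-phase map `Θ : H → S¹` is a homomorphism with kernel the spatial subgroup `K`, so `H/K` embeds in
an abelian group; here `S¹` is replaced by the scaling group `(ℝ_{>0}, ·)`) = Golubitsky–Stewart–Schaeffer
1988 Ch. XVI §7 Prop. 7.2; the reversing case `R_{2θ} ∈ K` is the exact algebraic core of Golubitsky–
Stewart 2002 Ch. 6 Def. 6.14 / Thm 6.16 (Krupa 1990) / Example 6.18 (a reflection that is a spatio-temporal
symmetry forces the twist into `{1, R_π}` modulo `K`); the co-rotating ansatz is the relative-periodic-orbit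
template of Thm 6.26. New here: the Navier–Stokes statements (Oseen gauge, CLASS level, K4 forms), which
upgrade «periodic» to «≡ 0» via the irrational closure and KNSS 2009 Thm 5.3.

[cite: KochNadirashviliSereginSverak2009, §4 and Thm 5.3 (arXiv:0709.3599)]
[cite: BradshawTsai2017CPDE, §1 (v-RDSS), arXiv:1610.05680 p. 3]
[cite: ChaeWolf2017RemovingDSS, (1.2) p. 3]
[cite: PineauVicol2026, (1.13a) (arXiv:2607.09619 p. 7)]
[cite: GolubitskyStewart2002, Ch. 3 Lemma 3.1(b); Ch. 6 Def. 6.14, Thm 6.16, Ex. 6.18, Thm 6.26]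
[cite: GolubitskyStewartSchaeffer1988, Ch. XVI §7 Prop. 7.2]
[cite: Krupa1990]
-/

noncomputable section

set_option linter.dupNamespace false

namespace Summit.NavierStokesRegularity.NavierStokesRegularity.Theorems.SpatioTemporal

open MeasureTheory Set Function Filter Metric
open Literature.Analysis.FluidPDE
open Summit.NavierStokesRegularity.NavierStokesRegularity.Theorems
open scoped Topology


/-- Slices of a Type-I ancient mild field are continuous. -/
private theorem slice_continuous {C₀ : ℝ} {V : ℝ → (EuclideanSpace ℝ (Fin 3)) → (EuclideanSpace ℝ (Fin 3))} (hV : IsTypeIAncientMild C₀ V)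
    {t : ℝ} (ht : t < 0) : Continuous (V t) := by
  have h : ContinuousOn (uncurry V ∘ fun x : (EuclideanSpace ℝ (Fin 3)) => (t, x)) univ :=
    hV.1.continuousOn.comp (continuous_const.prodMk continuous_id).continuousOn
      fun x _ => ⟨ht, mem_univ _⟩
  exact (continuousOn_univ.1 h).congr fun x => rfl

/-! ### The commutator of two rotated-DSS structures is a symmetry of every slice -/

/-- **Two rotated-DSS structures ⇒ every slice is equivariant under the commutator `B A B⁻¹ A⁻¹`.**
Stated with the structures restricted to negative times (the only times the class constrains). Pure
algebra: compare `V(t₀) = cμ A⁻¹B⁻¹ V(c²μ²t₀)(cμ BA ·)` with `V(t₀) = cμ B⁻¹A⁻¹ V(c²μ²t₀)(cμ AB ·)`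
(printed skeleton: the spatio-temporal symmetry group modulo the spatial one is abelian).
[cite: GolubitskyStewart2002, Ch. 3 Lemma 3.1(b)] [cite: GolubitskyStewartSchaeffer1988, Ch. XVI §7 Prop. 7.2] -/
theorem slices_equivariant_commutator {c μ : ℝ} (hc : 0 < c) (hμ : 0 < μ)
    {A B : (EuclideanSpace ℝ (Fin 3)) ≃ₗᵢ[ℝ] (EuclideanSpace ℝ (Fin 3))} {V : ℝ → (EuclideanSpace ℝ (Fin 3)) → (EuclideanSpace ℝ (Fin 3))}
    (hA : ∀ t < 0, ∀ x, c • A.symm (V (c ^ 2 * t) (c • A x)) = V t x)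
    (hB : ∀ t < 0, ∀ x, μ • B.symm (V (μ ^ 2 * t) (μ • B x)) = V t x) :
    ∀ t < 0, ∀ x, V t (B (A (B.symm (A.symm x)))) = B (A (B.symm (A.symm (V t x)))) := by
  intro t ht x
  have hcμ : c * μ ≠ 0 := mul_ne_zero hc.ne' hμ.ne'
  set t₀ : ℝ := (c ^ 2 * μ ^ 2)⁻¹ * t with ht₀
  have hpos : 0 < c ^ 2 * μ ^ 2 := by positivity
  have ht₀neg : t₀ < 0 := mul_neg_of_pos_of_neg (inv_pos.2 hpos) ht
  have hct₀ : c ^ 2 * t₀ < 0 := mul_neg_of_pos_of_neg (by positivity) ht₀neg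
  have hμt₀ : μ ^ 2 * t₀ < 0 := mul_neg_of_pos_of_neg (by positivity) ht₀neg
  have e1 : μ ^ 2 * (c ^ 2 * t₀) = t := by
    rw [ht₀]; field_simp
  have e2 : c ^ 2 * (μ ^ 2 * t₀) = t := by
    rw [ht₀]; field_simp
  set x' : (EuclideanSpace ℝ (Fin 3)) := (c * μ)⁻¹ • B.symm (A.symm x) with hx'
  have ha1 : μ • B (c • A x') = B (A (B.symm (A.symm x))) := by
    simp only [hx', LinearIsometryEquiv.map_smul, smul_smul]
    rw [show μ * (c * (c * μ)⁻¹) = 1 by field_simp, one_smul]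
  have ha2 : c • A (μ • B x') = x := by
    simp only [hx', LinearIsometryEquiv.map_smul, smul_smul, LinearIsometryEquiv.apply_symm_apply]
    rw [show c * (μ * (c * μ)⁻¹) = 1 by field_simp, one_smul]
  -- first order: `A` then `B`
  have h1 := hA t₀ ht₀neg x'
  rw [← hB (c ^ 2 * t₀) hct₀ (c • A x'), e1, ha1] at h1
  -- second order: `B` then `A`
  have h2 := hB t₀ ht₀neg x'
  rw [← hA (μ ^ 2 * t₀) hμt₀ (μ • B x'), e2, ha2] at h2
  have h3 := h1.trans h2.symm
  simp only [LinearIsometryEquiv.map_smul, smul_smul] at h3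
  rw [mul_comm μ c] at h3
  have h4 : A.symm (B.symm (V t (B (A (B.symm (A.symm x)))))) = B.symm (A.symm (V t x)) :=
    smul_right_injective (EuclideanSpace ℝ (Fin 3)) hcμ h3
  have h5 := congrArg (fun z => B (A z)) h4
  simpa only [LinearIsometryEquiv.apply_symm_apply] using h5

/-- The same with both structures given for all times (`IsRotatedDSS`, Chae–Wolf Def. 1.1 form). -/
theorem slices_equivariant_commutator' {c μ : ℝ} (hc : 0 < c) (hμ : 0 < μ)
    {A B : (EuclideanSpace ℝ (Fin 3)) ≃ₗᵢ[ℝ] (EuclideanSpace ℝ (Fin 3))} {V : ℝ → (EuclideanSpace ℝ (Fin 3)) → (EuclideanSpace ℝ (Fin 3))} (hA : IsRotatedDSS c A V) (hB : IsRotatedDSS μ B V) :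
    ∀ t < 0, ∀ x, V t (B (A (B.symm (A.symm x)))) = B (A (B.symm (A.symm (V t x)))) :=
  slices_equivariant_commutator hc hμ (fun t _ x => hA t x) (fun t _ x => hB t x)

/-! ### Reversing spatio-temporal symmetry: the commutator is `R_{−2θ}` -/

/-- For `A = R_θ` and a rotation-REVERSING `g`, the commutator `g R_θ g⁻¹ R_{−θ}` is `R_{−2θ}`. -/
theorem commutator_of_reverses {θ : ℝ} {g : (EuclideanSpace ℝ (Fin 3)) ≃ₗᵢ[ℝ] (EuclideanSpace ℝ (Fin 3))}
    (hg : ∀ φ y, g (rotZ φ y) = rotZ (-φ) (g y)) (x : (EuclideanSpace ℝ (Fin 3))) :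
    g (rotZLIE θ (g.symm ((rotZLIE θ).symm x))) = rotZ (-(2 * θ)) x := by
  rw [rotZLIE_apply, rotZLIE_symm_apply, hg, LinearIsometryEquiv.apply_symm_apply, ← rotZ_add]
  congr 1; ring

/-- **T25 (algebra): a spatio-temporal reversing symmetry makes the twist squared a SPATIAL symmetry.**
`(c, R_θ)`-RDSS and `(μ, g)`-RDSS on negative times with `g` rotation-reversing ⇒ every slice is
`R_{−2θ}`-equivariant. Compare `ReversingIsotropy.twistSq_equivariant_of_reverses` (K0d), where `g`
itself had to be a symmetry of the slices. -/
theorem twistSq_equivariant_of_spatioTemporalReversing {c μ θ : ℝ} (hc : 0 < c) (hμ : 0 < μ)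
    {g : (EuclideanSpace ℝ (Fin 3)) ≃ₗᵢ[ℝ] (EuclideanSpace ℝ (Fin 3))} (hg : ∀ φ y, g (rotZ φ y) = rotZ (-φ) (g y)) {V : ℝ → (EuclideanSpace ℝ (Fin 3)) → (EuclideanSpace ℝ (Fin 3))}
    (hR : ∀ t < 0, ∀ x, c • (rotZLIE θ).symm (V (c ^ 2 * t) (c • rotZLIE θ x)) = V t x)
    (hG : ∀ t < 0, ∀ x, μ • g.symm (V (μ ^ 2 * t) (μ • g x)) = V t x) :
    ∀ t < 0, ∀ x, V t (rotZ (-(2 * θ)) x) = rotZ (-(2 * θ)) (V t x) := by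
  intro t ht x
  have h := slices_equivariant_commutator hc hμ hR hG t ht x
  rwa [commutator_of_reverses hg, commutator_of_reverses hg] at h

/-- **T25 (Oseen gauge): Type-I ancient mild + `(c, R_θ)`-RDSS + a spatio-temporal REVERSING symmetry
`(μ, g)` + `θ/π ∉ ℚ` ⇒ trivial.** No symmetry of any individual slice is assumed. -/
theorem spatioTemporalReversing_trivial {C₀ c μ θ : ℝ} (hc : 0 < c) (hμ : 0 < μ)
    (hθ : Irrational (θ / Real.pi))
    {g : (EuclideanSpace ℝ (Fin 3)) ≃ₗᵢ[ℝ] (EuclideanSpace ℝ (Fin 3))} (hg : ∀ φ y, g (rotZ φ y) = rotZ (-φ) (g y)) {V : ℝ → (EuclideanSpace ℝ (Fin 3)) → (EuclideanSpace ℝ (Fin 3))}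
    (hV : IsTypeIAncientMild C₀ V) (hdec : HasTypeIDecay C₀ V)
    (hR : ∀ t < 0, ∀ x, c • (rotZLIE θ).symm (V (c ^ 2 * t) (c • rotZLIE θ x)) = V t x)
    (hG : ∀ t < 0, ∀ x, μ • g.symm (V (μ ^ 2 * t) (μ • g x)) = V t x) :
    ∀ t < 0, ∀ x, V t x = 0 := by
  have hVc : ∀ t < 0, Continuous (V t) := fun t ht => slice_continuous hV ht
  have hsq := twistSq_equivariant_of_spatioTemporalReversing hc hμ hg hR hG
  have hψ : Irrational (-(2 * θ) / (2 * Real.pi)) := by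
    rw [show -(2 * θ) / (2 * Real.pi) = -(θ / Real.pi) by field_simp]
    exact hθ.neg
  have hax : ∀ t < 0, IsAxisymmetric (V t) := fun t ht =>
    CorkscrewProfile.Birth.isAxisymmetric_of_equivariant_irrational (hVc t ht) hψ (hsq t ht)
  have hVmeas : ∀ t < 0, AEStronglyMeasurable (V t) volume := fun t ht =>
    (hVc t ht).aestronglyMeasurable
  intro t ht x
  have hz := typeI_ancient_axisymmetric_ae_zero hV.isAncientMildSolution hVmeas hdec hax t ht
  have hV0 : V t = 0 := Measure.eq_of_ae_eq hz (hVc t ht) continuous_const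
  exact congrFun hV0 x

/-- **T25 at CLASS level.** Hypothesis list = `RdssProfileTruncation`'s (ancient mild, measurable slices,
`(c, R_θ)`-RDSS, Type-I `M`) with `θ/π ∉ ℚ`, plus ONE spatio-temporal reversing symmetry
`IsRotatedDSS μ g u` (`μ > 0`, `g` rotation-reversing): the cell is EMPTY. -/
theorem rdssClass_spatioTemporalReversing_empty {θ : ℝ} (hθ : Irrational (θ / Real.pi))
    {g : (EuclideanSpace ℝ (Fin 3)) ≃ₗᵢ[ℝ] (EuclideanSpace ℝ (Fin 3))} (hg : ∀ φ y, g (rotZ φ y) = rotZ (-φ) (g y)) (M : ℝ) :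
    ¬ ∃ (c μ : ℝ) (u : ℝ → (EuclideanSpace ℝ (Fin 3)) → (EuclideanSpace ℝ (Fin 3))), 1 < c ∧ 0 < μ ∧ IsAncientMildSolution 1 u ∧
      (∀ t < 0, AEStronglyMeasurable (u t) volume) ∧ IsRotatedDSS c (rotZLIE θ) u ∧ HasTypeIDecay M u ∧
      IsRotatedDSS μ g u ∧ ¬ (∀ t < 0, u t =ᵐ[volume] 0) := by
  rintro ⟨c, μ, u, hc, hμ, hmild, hmeas, hR, hdec, hG, hne⟩
  obtain ⟨V, hT, hRV, hVdec, hVu, hV0⟩ := rdssClass_smoothRepresentative_ae hc hmild hmeas hR hdec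
  have hVc : ∀ t < 0, Continuous (V t) := fun t ht => slice_continuous hT ht
  have hGV : IsRotatedDSS μ g V := isRotatedDSS_of_ae_slice_eq hμ hG hVc hVu hV0
  have hz := spatioTemporalReversing_trivial (lt_trans zero_lt_one hc) hμ hθ hg hT hVdec
    (fun t _ x => hRV t x) (fun t _ x => hGV t x)
  exact hne fun t ht => by
    filter_upwards [hVu t ht] with x hx
    rw [← hx, hz t ht x]
    rfl

/-- A rotation-reversing `g` exists (the vertical mirror `reflY`), so T25 is not vacuous in `g`. -/
example : ∀ φ y, reflY (rotZ φ y) = rotZ (-φ) (reflY y) := ReversingIsotropy.reversesRotZ_reflY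

/-! ### K4 reading: co-rotating periodic profiles -/

/-- **T25 for K4 (co-rotating profile `W`, `L = 2 log c`-periodic, any speed `α`).** The field
`pvAnsatz α W` is automatically `(c, R_{−αL})`-RDSS; a spatio-temporal reversing symmetry `(μ, g)` on
negative times then forces every slice to be `R_{2αL}`-equivariant, and if `αL/π ∉ ℚ` the profile
vanishes. (At `αL/π ∈ ℚ` the conclusion is the finite-order spatial symmetry `R_{2αL}`.) -/
theorem corotating_spatioTemporalReversing_trivial {C₀ α c μ : ℝ} (hc : 1 < c) (hμ : 0 < μ)
    (hirr : Irrational (α * (2 * Real.log c) / Real.pi))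
    {g : (EuclideanSpace ℝ (Fin 3)) ≃ₗᵢ[ℝ] (EuclideanSpace ℝ (Fin 3))} (hg : ∀ φ y, g (rotZ φ y) = rotZ (-φ) (g y)) {V : ℝ → (EuclideanSpace ℝ (Fin 3)) → (EuclideanSpace ℝ (Fin 3))}
    (hV : IsTypeIAncientMild C₀ V) (hdec : HasTypeIDecay C₀ V)
    {W : (EuclideanSpace ℝ (Fin 3)) → ℝ → (EuclideanSpace ℝ (Fin 3))} (hper : ∀ (y : (EuclideanSpace ℝ (Fin 3))) (s : ℝ), W y (s + 2 * Real.log c) = W y s)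
    (hans : ∀ t < 0, ∀ x, V t x = pvAnsatz α W t x)
    (hG : ∀ t < 0, ∀ x, μ • g.symm (V (μ ^ 2 * t) (μ • g x)) = V t x) : W = 0 := by
  have hc0 : 0 < c := lt_trans zero_lt_one hc
  have hR0 := PineauVicol2026.isRotatedDSS_pvAnsatz (α := α) (U := W) hc0 hper
  -- transfer the automatic RDSS structure to `V` on negative times
  have hR : ∀ t < 0, ∀ x, c • (rotZLIE (-(α * (2 * Real.log c)))).symm
      (V (c ^ 2 * t) (c • rotZLIE (-(α * (2 * Real.log c))) x)) = V t x := by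
    intro t ht x
    have hct : c ^ 2 * t < 0 := mul_neg_of_pos_of_neg (by positivity) ht
    rw [hans t ht, hans _ hct]
    exact hR0 t x
  have hθ : Irrational (-(α * (2 * Real.log c)) / Real.pi) := by
    rw [neg_div]; exact hirr.neg
  have hzero := spatioTemporalReversing_trivial hc0 hμ hθ hg hV hdec hR hG
  funext y s
  set t : ℝ := -Real.exp (-s) with ht
  have htneg : t < 0 := neg_neg_of_pos (Real.exp_pos _)
  have hlog : -Real.log (-t) = s := by rw [ht, neg_neg, Real.log_exp, neg_neg]
  have hsq : 0 < Real.sqrt (-t) := Real.sqrt_pos.2 (by linarith)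
  have h1 := hzero t htneg (Real.sqrt (-t) • rotZ (α * s) y)
  rw [hans t htneg] at h1
  simp only [pvAnsatz, hlog, smul_smul, inv_mul_cancel₀ hsq.ne', one_smul,
    ← rotZ_add, neg_add_cancel, rotZ_zero] at h1
  have h2 : rotZ (α * s) (W y s) = 0 := by
    rcases smul_eq_zero.1 h1 with h0 | h0
    · exact absurd h0 (inv_ne_zero hsq.ne')
    · exact h0
  have h3 := congrArg (rotZ (-(α * s))) h2
  have hz0 : rotZ (-(α * s)) (0 : (EuclideanSpace ℝ (Fin 3))) = 0 := by
    rw [← rotZL_apply, map_zero]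
  rw [← rotZ_add, neg_add_cancel, rotZ_zero, hz0] at h3
  exact h3

/-- **The rational case, census form**: whatever `θ`, a spatio-temporal reversing symmetry puts `R_{2θ}`
into the spatial isotropy of every slice (here for all-time structures). -/
theorem twistSq_mem_isotropy_of_spatioTemporalReversing {c μ θ : ℝ} (hc : 0 < c) (hμ : 0 < μ)
    {g : (EuclideanSpace ℝ (Fin 3)) ≃ₗᵢ[ℝ] (EuclideanSpace ℝ (Fin 3))} (hg : ∀ φ y, g (rotZ φ y) = rotZ (-φ) (g y)) {V : ℝ → (EuclideanSpace ℝ (Fin 3)) → (EuclideanSpace ℝ (Fin 3))}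
    (hR : IsRotatedDSS c (rotZLIE θ) V) (hG : IsRotatedDSS μ g V) :
    ∀ t < 0, ∀ x, V t (rotZ (2 * θ) x) = rotZ (2 * θ) (V t x) := by
  intro t ht x
  have h := twistSq_equivariant_of_spatioTemporalReversing hc hμ hg (fun t _ x => hR t x)
    (fun t _ x => hG t x) t ht (rotZ (2 * θ) x)
  rw [← rotZ_add, show -(2 * θ) + 2 * θ = 0 by ring, rotZ_zero] at h
  have h' := congrArg (rotZ (2 * θ)) h
  rwa [← rotZ_add, show 2 * θ + -(2 * θ) = 0 by ring, rotZ_zero, eq_comm] at h'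

end Summit.NavierStokesRegularity.NavierStokesRegularity.Theorems.SpatioTemporal

end
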